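import Literature.RingTheory.NoetherNormalization.LinearChange
import Literature.AlgebraicGeometry.Motives.CurveThroughTwoPointsHypersurfaceModel

/-!
# LangWeilTransfer, support item `TameResolution` (stmt-ValiantsHypothesis-6378) — integer linear
# Noether position of a finite point configuration (algebraic core of step (N))

Route `LangWeilTransfer` of `ValiantsHypothesis` (conditional route; honest framing: bookkeeping,
nothing here bears on VP ≠ VNP). Step (N) of the architecture note of val-lit-p6 g9: for elements
`y_1, …, y_m` of a field of characteristic `0` there is an INTEGER unimodular linear change of
coordinates, assembled from the shears `X_{k+1} ↦ X_{k+1} + w_k X_0` (`w_k ∈ ℕ`) of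
`Literature.RingTheory.NoetherNormalization.LinearChange`, after which the new coordinates split
as `T̄ ⊔ ξ` with `T̄` algebraically independent over `ℚ` and every `ξ_j` integral over `ℚ[T̄]`
(Greuel–Pfister 2002, Thm. 3.4.1, run over `ℚ` with shear vectors in `{0, …, deg}`). This is the
hypothesis `hint` / `hθℚ` of `exists_parametrisation`; the quantitative version (heights of the
change of coordinates, degrees of the relations from `eliminant_identity_coord`) is tracked in a
sequel.

* `isIntegral_of_subalgebra_le`, `isIntegral_adjoin_of_tower` — integrality bookkeeping over
  `ℚ`-subalgebras;
* `exists_shear_isIntegral_nat` — one round: a dependent family becomes, after an integer shear,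
  a family whose first member is integral over the others;
* `exists_integer_noether_position` — the induction: `Γ : ℤ[Y] ≃ ℤ[T][X']` with `T̄` independent
  and `ξ` integral, in the `∃ monic` form over `ℚ[T]`.
-/

noncomputable section

open MvPolynomial

-- the summit and the problem share the name `ValiantsHypothesis` (D-0017 single-conjunct layout)
set_option linter.dupNamespace false

namespace Summit.ValiantsHypothesis.ValiantsHypothesis.Theorems.LangWeilTransfer

variable {F₀ : Type*} [Field F₀] [CharZero F₀]

/-! ### Integrality over `ℚ`-subalgebras -/

/-- Integrality passes to a larger base subalgebra. -/
theorem isIntegral_of_subalgebra_le {S₁ S₂ : Subalgebra ℚ F₀} (h : S₁ ≤ S₂) {x : F₀}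
    (hx : IsIntegral S₁ x) : IsIntegral S₂ x := by
  obtain ⟨p, hp, hpx⟩ := hx
  refine ⟨p.map (Subalgebra.inclusion h).toRingHom, hp.map _, ?_⟩
  rw [Polynomial.eval₂_map]
  have : (algebraMap S₂ F₀).comp (Subalgebra.inclusion h).toRingHom = algebraMap S₁ F₀ := by
    ext y; rfl
  rw [this]; exact hpx

/-- **Tower step.** If every element of `t` is integral over `ℚ[s]` and `x` is integral over
`ℚ[t]`, then `x` is integral over `ℚ[s]`. -/
theorem isIntegral_adjoin_of_tower (s t : Set F₀)
    (hts : ∀ y ∈ t, IsIntegral (Algebra.adjoin ℚ s) y) {x : F₀}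
    (hx : IsIntegral (Algebra.adjoin ℚ t) x) : IsIntegral (Algebra.adjoin ℚ s) x := by
  set R₁ : Subalgebra ℚ F₀ := Algebra.adjoin ℚ s with hR₁
  set A₂ : Subalgebra ℚ F₀ := Algebra.adjoin ℚ (s ∪ t) with hA₂
  have hle : R₁ ≤ A₂ := Algebra.adjoin_mono Set.subset_union_left
  letI : Algebra R₁ A₂ := (Subalgebra.inclusion hle).toRingHom.toAlgebra
  haveI : IsScalarTower R₁ A₂ F₀ := IsScalarTower.of_algebraMap_eq (fun _ => rfl)
  -- `A₂` is integral over `R₁`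
  have hsub : s ∪ t ⊆ ((integralClosure R₁ F₀).restrictScalars ℚ : Subalgebra ℚ F₀) := by
    rintro y (hy | hy)
    · change IsIntegral R₁ y
      have : y = algebraMap R₁ F₀ ⟨y, Algebra.subset_adjoin hy⟩ := rfl
      rw [this]; exact isIntegral_algebraMap
    · exact hts y hy
  have hA₂le : A₂ ≤ (integralClosure R₁ F₀).restrictScalars ℚ := Algebra.adjoin_le hsub
  haveI : Algebra.IsIntegral R₁ A₂ := by
    refine ⟨fun z => ?_⟩
    have hz : IsIntegral R₁ (z : F₀) := by
      have := hA₂le z.2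
      exact this
    exact (isIntegral_algHom_iff (IsScalarTower.toAlgHom R₁ A₂ F₀) Subtype.val_injective).1 hz
  have hx' : IsIntegral A₂ x :=
    isIntegral_of_subalgebra_le (Algebra.adjoin_mono Set.subset_union_right) hx
  exact isIntegral_trans x hx'

/-! ### One round: an integer shear -/

/-- **One round of integer Noether normalisation.** If `a : Fin (i+1) → F₀` is algebraically
dependent over `ℚ`, there is `w ∈ ℕ^i` such that `a 0` is integral over
`ℚ[a_{k+1} - w_k a_0 : k]`. -/
theorem exists_shear_isIntegral_nat {i : ℕ} (a : Fin (i + 1) → F₀) (ha : ¬ AlgebraicIndependent ℚ a) :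
    ∃ w : Fin i → ℕ, IsIntegral (Algebra.adjoin ℚ (Set.range fun k : Fin i => a k.succ - (w k : F₀) * a 0)) (a 0) := by
  classical
  rw [algebraicIndependent_iff] at ha
  push Not at ha
  obtain ⟨f, hfa, hf⟩ := ha
  set N := f.totalDegree with hN
  let S : Finset ℚ := Finset.image (fun n : ℕ => (n : ℚ)) (Finset.range (N + 1))
  have hS : f.totalDegree < S.card := by
    rw [Finset.card_image_of_injective _ Nat.cast_injective, Finset.card_range]; omega
  obtain ⟨v, hvS, c, hc0, hmon, -⟩ :=
    Literature.RingTheory.NoetherNormalization.exists_linearChange_monic hf S hS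
  have hw : ∀ k, ∃ n : ℕ, (n : ℚ) = v k := fun k => by
    obtain ⟨n, -, hn⟩ := Finset.mem_image.1 (hvS k); exact ⟨n, hn⟩
  choose w hw using hw
  refine ⟨w, ?_⟩
  set a' : Fin i → F₀ := fun k => a k.succ - (w k : F₀) * a 0 with ha'
  set g := Literature.RingTheory.NoetherNormalization.linearChange v (C c * f) with hg
  -- the relation survives the shear: `g(a 0, a') = (C c * f)(a) = 0`
  have hrel : aeval (Fin.cons (a 0) a' : Fin (i + 1) → F₀) g = 0 := by
    have hcomp := MvPolynomial.comp_aeval (R := ℚ)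
      (f := (Fin.cons (X 0) fun k => X k.succ + C (v k) * X 0 : Fin (i + 1) → MvPolynomial (Fin (i + 1)) ℚ))
      (aeval (Fin.cons (a 0) a' : Fin (i + 1) → F₀))
    have hpt : (fun j => aeval (Fin.cons (a 0) a' : Fin (i + 1) → F₀)
        ((Fin.cons (X 0) fun k => X k.succ + C (v k) * X 0 : Fin (i + 1) → MvPolynomial (Fin (i + 1)) ℚ) j)) = a := by
      funext j
      refine Fin.cases ?_ (fun k => ?_) j
      · simp only [Fin.cons_zero, aeval_X]
      · simp only [Fin.cons_succ, Fin.cons_zero, map_add, map_mul, aeval_X, ha', ← hw k, map_natCast]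
        ring
    rw [hpt] at hcomp
    have h := congrArg (fun φ => φ (C c * f)) hcomp
    simp only [AlgHom.comp_apply] at h
    rw [hg, Literature.RingTheory.NoetherNormalization.linearChange, h, map_mul, hfa, mul_zero]
  -- the monic polynomial over `ℚ[a']`
  set R₁ : Subalgebra ℚ F₀ := Algebra.adjoin ℚ (Set.range a') with hR₁
  let ρ₁ : MvPolynomial (Fin i) ℚ →ₐ[ℚ] R₁ :=
    aeval fun k => (⟨a' k, Algebra.subset_adjoin ⟨k, rfl⟩⟩ : R₁)
  have hρ₁ : (algebraMap R₁ F₀).comp ρ₁.toRingHom = (aeval a' : MvPolynomial (Fin i) ℚ →ₐ[ℚ] F₀).toRingHom := by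
    have : (R₁.val).comp ρ₁ = aeval a' := by
      rw [MvPolynomial.comp_aeval]; rfl
    exact congrArg AlgHom.toRingHom this
  refine ⟨(finSuccEquiv ℚ i g).map ρ₁.toRingHom, hmon.map _, ?_⟩
  rw [Polynomial.eval₂_map, hρ₁]
  have h := Literature.AlgebraicGeometry.Motives.TwoPointPencil.aeval_cons_eq_aevalTower a' (a 0) g
  have h' : Polynomial.eval₂ (aeval a' : MvPolynomial (Fin i) ℚ →ₐ[ℚ] F₀).toRingHom (a 0) (finSuccEquiv ℚ i g) =
      Polynomial.aevalTower (aeval a' : MvPolynomial (Fin i) ℚ →ₐ[ℚ] F₀) (a 0) (finSuccEquiv ℚ i g) := rfl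
  rw [h', ← h]
  exact hrel

/-! ### The induction -/

/-- The independent case: nothing to do (`r = i`, `n = 0`). -/
theorem noether_indep_case {i p : ℕ} (a : Fin i → F₀) (b : Fin p → F₀) (ha : AlgebraicIndependent ℚ a)
    (hb : ∀ l, IsIntegral (Algebra.adjoin ℚ (Set.range a)) (b l)) :
    ∃ (r n : ℕ) (Γ : MvPolynomial (Fin i) ℤ ≃+* MvPolynomial (Fin n) (MvPolynomial (Fin r) ℤ)), n + r = i ∧
      AlgebraicIndependent ℚ (fun k => eval₂Hom (Int.castRingHom F₀) a (Γ.symm (C (X k)))) ∧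
      (∀ j, IsIntegral (Algebra.adjoin ℚ (Set.range fun k => eval₂Hom (Int.castRingHom F₀) a (Γ.symm (C (X k)))))
        (eval₂Hom (Int.castRingHom F₀) a (Γ.symm (X j)))) ∧
      (∀ l, IsIntegral (Algebra.adjoin ℚ (Set.range fun k => eval₂Hom (Int.castRingHom F₀) a (Γ.symm (C (X k)))))
        (b l)) := by
  refine ⟨i, 0, (isEmptyRingEquiv (MvPolynomial (Fin i) ℤ) (Fin 0)).symm, by omega, ?_⟩
  have hT : (fun k => eval₂Hom (Int.castRingHom F₀) a
      ((isEmptyRingEquiv (MvPolynomial (Fin i) ℤ) (Fin 0)).symm.symm (C (X k)))) = a := by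
    funext k
    rw [RingEquiv.symm_symm, isEmptyRingEquiv_eq_coeff_zero, coeff_zero_C, eval₂Hom_X']
  rw [hT]
  exact ⟨ha, fun j => Fin.elim0 j, hb⟩

/-- **The induction** behind `exists_integer_noether_position`: active coordinates `a`, already
processed coordinates `b` (integral over `ℚ[a]`). -/
theorem noether_induction (i : ℕ) : ∀ (p : ℕ) (a : Fin i → F₀) (b : Fin p → F₀),
    (∀ l, IsIntegral (Algebra.adjoin ℚ (Set.range a)) (b l)) →
    ∃ (r n : ℕ) (Γ : MvPolynomial (Fin i) ℤ ≃+* MvPolynomial (Fin n) (MvPolynomial (Fin r) ℤ)), n + r = i ∧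
      AlgebraicIndependent ℚ (fun k => eval₂Hom (Int.castRingHom F₀) a (Γ.symm (C (X k)))) ∧
      (∀ j, IsIntegral (Algebra.adjoin ℚ (Set.range fun k => eval₂Hom (Int.castRingHom F₀) a (Γ.symm (C (X k)))))
        (eval₂Hom (Int.castRingHom F₀) a (Γ.symm (X j)))) ∧
      (∀ l, IsIntegral (Algebra.adjoin ℚ (Set.range fun k => eval₂Hom (Int.castRingHom F₀) a (Γ.symm (C (X k)))))
        (b l)) := by
  induction i with
  | zero =>
    intro p a b hb
    exact noether_indep_case a b (algebraicIndependent_empty_type) hb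
  | succ i ih =>
    intro p a b hb
    by_cases hind : AlgebraicIndependent ℚ a
    · exact noether_indep_case a b hind hb
    -- one shear, then the induction hypothesis on the sheared tail
    obtain ⟨w, hw⟩ := exists_shear_isIntegral_nat a hind
    set a' : Fin i → F₀ := fun k => a k.succ - (w k : F₀) * a 0 with ha'
    have hrange : ∀ y ∈ Set.range a, IsIntegral (Algebra.adjoin ℚ (Set.range a')) y := by
      rintro _ ⟨j, rfl⟩
      refine Fin.cases ?_ (fun k => ?_) j
      · exact hw
      · -- `a k.succ = a' k + w_k a 0`
        have hmem : a k.succ ∈ Algebra.adjoin ℚ (Set.range a' ∪ {a 0}) := by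
          have h1 : a' k ∈ Algebra.adjoin ℚ (Set.range a' ∪ {a 0}) :=
            Algebra.subset_adjoin (Or.inl ⟨k, rfl⟩)
          have h2 : a 0 ∈ Algebra.adjoin ℚ (Set.range a' ∪ {a 0}) :=
            Algebra.subset_adjoin (Or.inr rfl)
          have : a k.succ = a' k + (w k : F₀) * a 0 := by rw [ha']; ring
          rw [this]
          exact add_mem h1 (mul_mem (natCast_mem (Algebra.adjoin ℚ (Set.range a' ∪ {a 0})) (w k)) h2)
        have hint' : IsIntegral (Algebra.adjoin ℚ (Set.range a' ∪ {a 0})) (a k.succ) := by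
          have : a k.succ = algebraMap (Algebra.adjoin ℚ (Set.range a' ∪ {a 0})) F₀ ⟨_, hmem⟩ := rfl
          rw [this]; exact isIntegral_algebraMap
        refine isIntegral_adjoin_of_tower (Set.range a') (Set.range a' ∪ {a 0}) ?_ hint'
        rintro y (⟨k', rfl⟩ | rfl)
        · have : a' k' = algebraMap (Algebra.adjoin ℚ (Set.range a')) F₀ ⟨_, Algebra.subset_adjoin ⟨k', rfl⟩⟩ := rfl
          rw [this]; exact isIntegral_algebraMap
        · exact hw
    have hb' : ∀ l, IsIntegral (Algebra.adjoin ℚ (Set.range a')) ((Fin.cons (a 0) b : Fin (p + 1) → F₀) l) := by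
      intro l
      refine Fin.cases ?_ (fun l₀ => ?_) l
      · simpa only [Fin.cons_zero] using hw
      · simp only [Fin.cons_succ]
        exact isIntegral_adjoin_of_tower _ _ hrange (hb l₀)
    obtain ⟨r, n, Γ', hnr, hTind, hξ, hbint⟩ := ih (p + 1) a' (Fin.cons (a 0) b) hb'
    -- the new coordinate system on `Fin (i+1)`
    let Λw := (Literature.RingTheory.NoetherNormalization.linearChangeEquiv
      (fun k => ((w k : ℕ) : ℤ))).toRingEquiv
    let Φ₁ := (finSuccEquiv ℤ i).toRingEquiv
    let Φ₂ := Polynomial.mapEquiv Γ'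
    let Φ₃ := (finSuccEquiv (MvPolynomial (Fin r) ℤ) n).toRingEquiv.symm
    let Γ : MvPolynomial (Fin (i + 1)) ℤ ≃+* MvPolynomial (Fin (n + 1)) (MvPolynomial (Fin r) ℤ) :=
      (Λw.trans Φ₁).trans (Φ₂.trans Φ₃)
    -- evaluation of the inverse coordinate change
    set πa : MvPolynomial (Fin (i + 1)) ℤ →+* F₀ := eval₂Hom (Int.castRingHom F₀) a with hπa
    set πa' : MvPolynomial (Fin i) ℤ →+* F₀ := eval₂Hom (Int.castRingHom F₀) a' with hπa'
    have hH : (πa.comp (Λw.symm.toRingHom.comp (Φ₁.symm.toRingHom.comp (Polynomial.C)))) = πa' := by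
      refine MvPolynomial.ringHom_ext (fun z => ?_) (fun k => ?_)
      · simp only [eq_intCast, map_intCast]
      · have h1 : Φ₁.symm (Polynomial.C (X k)) = X k.succ := by
          change (finSuccEquiv ℤ i).symm (Polynomial.C (X k)) = X k.succ
          rw [AlgEquiv.symm_apply_eq, finSuccEquiv_X_succ]
        have h2 : Λw.symm (X k.succ) = X k.succ + C (-((w k : ℕ) : ℤ)) * X 0 := by
          change (Literature.RingTheory.NoetherNormalization.linearChangeEquiv
            (fun k => ((w k : ℕ) : ℤ))).symm (X k.succ) = _
          rw [Literature.RingTheory.NoetherNormalization.linearChangeEquiv, AlgEquiv.ofAlgHom_symm_apply,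
            Literature.RingTheory.NoetherNormalization.linearChange_X_succ]
          rfl
        simp only [RingHom.comp_apply, RingEquiv.toRingHom_eq_coe, RingHom.coe_coe, h1, h2, hπa, hπa', ha',
          map_add, map_mul, eval₂Hom_X', map_neg, map_natCast]
        ring
    have hX0 : πa (Γ.symm (X 0)) = a 0 := by
      have e3 : Φ₃.symm (X 0 : MvPolynomial (Fin (n + 1)) (MvPolynomial (Fin r) ℤ)) = Polynomial.X := by
        change finSuccEquiv (MvPolynomial (Fin r) ℤ) n (X 0) = Polynomial.X
        exact finSuccEquiv_X_zero
      have e2 : Φ₂.symm (Polynomial.X : Polynomial (MvPolynomial (Fin n) (MvPolynomial (Fin r) ℤ))) = Polynomial.X := by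
        change Polynomial.map _ Polynomial.X = Polynomial.X
        exact Polynomial.map_X _
      have e1 : Φ₁.symm (Polynomial.X : Polynomial (MvPolynomial (Fin i) ℤ)) = X 0 := by
        change (finSuccEquiv ℤ i).symm Polynomial.X = X 0
        rw [AlgEquiv.symm_apply_eq, finSuccEquiv_X_zero]
      have e0 : Λw.symm (X 0 : MvPolynomial (Fin (i + 1)) ℤ) = X 0 := by
        change (Literature.RingTheory.NoetherNormalization.linearChangeEquiv
          (fun k => ((w k : ℕ) : ℤ))).symm (X 0) = X 0
        rw [Literature.RingTheory.NoetherNormalization.linearChangeEquiv, AlgEquiv.ofAlgHom_symm_apply,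
          Literature.RingTheory.NoetherNormalization.linearChange_X_zero]
      change πa (Λw.symm (Φ₁.symm (Φ₂.symm (Φ₃.symm (X 0))))) = a 0
      rw [e3, e2, e1, e0, hπa, eval₂Hom_X']
    have hXs : ∀ j, πa (Γ.symm (X j.succ)) = πa' (Γ'.symm (X j)) := by
      intro j
      have e3 : Φ₃.symm (X j.succ : MvPolynomial (Fin (n + 1)) (MvPolynomial (Fin r) ℤ)) = Polynomial.C (X j) := by
        change finSuccEquiv (MvPolynomial (Fin r) ℤ) n (X j.succ) = Polynomial.C (X j)
        exact finSuccEquiv_X_succ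
      have e2 : Φ₂.symm (Polynomial.C (X j) : Polynomial (MvPolynomial (Fin n) (MvPolynomial (Fin r) ℤ))) =
          Polynomial.C (Γ'.symm (X j)) := by
        change Polynomial.map _ (Polynomial.C (X j)) = _
        rw [Polynomial.map_C]; rfl
      change πa (Λw.symm (Φ₁.symm (Φ₂.symm (Φ₃.symm (X j.succ))))) = _
      rw [e3, e2, ← hH]
      rfl
    have hCX : ∀ k, πa (Γ.symm (C (X k))) = πa' (Γ'.symm (C (X k))) := by
      intro k
      have e3 : Φ₃.symm (C (X k) : MvPolynomial (Fin (n + 1)) (MvPolynomial (Fin r) ℤ)) = Polynomial.C (C (X k)) := by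
        change finSuccEquiv (MvPolynomial (Fin r) ℤ) n (C (X k)) = Polynomial.C (C (X k))
        simp only [finSuccEquiv_apply, eval₂Hom_C, RingHom.comp_apply]
      have e2 : Φ₂.symm (Polynomial.C (C (X k)) : Polynomial (MvPolynomial (Fin n) (MvPolynomial (Fin r) ℤ))) =
          Polynomial.C (Γ'.symm (C (X k))) := by
        change Polynomial.map _ (Polynomial.C (C (X k))) = _
        rw [Polynomial.map_C]; rfl
      change πa (Λw.symm (Φ₁.symm (Φ₂.symm (Φ₃.symm (C (X k)))))) = _
      rw [e3, e2, ← hH]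
      rfl
    refine ⟨r, n + 1, Γ, by omega, ?_⟩
    have hTeq : (fun k => πa (Γ.symm (C (X k)))) = fun k => πa' (Γ'.symm (C (X k))) := funext hCX
    rw [hTeq]
    refine ⟨hTind, fun j => ?_, fun l => ?_⟩
    · refine Fin.cases ?_ (fun j₀ => ?_) j
      · rw [hX0]; simpa only [Fin.cons_zero] using hbint 0
      · rw [hXs]; exact hξ j₀
    · simpa only [Fin.cons_succ] using hbint l.succ

/-! ### The statement -/

/-- **Integer linear Noether position (algebraic core of step (N)).** For `y : Fin m → F₀` in a
field of characteristic `0` there are `r + n = m` and a ring isomorphism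
`Γ : ℤ[Y] ≃ ℤ[T][X']` (a composite of integer shears and the splitting of variables) such that,
with `T̄_k = Γ⁻¹(T_k)(y)` and `ξ_j = Γ⁻¹(X'_j)(y)`: `T̄` is algebraically independent over `ℚ`
and every `ξ_j` has a MONIC equation over `ℚ[T]` (evaluated through `aeval T̄`). -/
theorem exists_integer_noether_position {m : ℕ} (y : Fin m → F₀) :
    ∃ (r n : ℕ) (Γ : MvPolynomial (Fin m) ℤ ≃+* MvPolynomial (Fin n) (MvPolynomial (Fin r) ℤ)), n + r = m ∧
      AlgebraicIndependent ℚ (fun k => eval₂Hom (Int.castRingHom F₀) y (Γ.symm (C (X k)))) ∧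
      ∀ j, ∃ p : Polynomial (MvPolynomial (Fin r) ℚ), p.Monic ∧
        (p.map (aeval (fun k => eval₂Hom (Int.castRingHom F₀) y (Γ.symm (C (X k)))) :
          MvPolynomial (Fin r) ℚ →ₐ[ℚ] F₀).toRingHom).eval (eval₂Hom (Int.castRingHom F₀) y (Γ.symm (X j))) = 0 := by
  obtain ⟨r, n, Γ, hnr, hT, hξ, -⟩ := noether_induction m 0 y (Fin.elim0 ·) (fun l => Fin.elim0 l)
  refine ⟨r, n, Γ, hnr, hT, fun j => ?_⟩
  set T : Fin r → F₀ := fun k => eval₂Hom (Int.castRingHom F₀) y (Γ.symm (C (X k))) with hTdef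
  -- lift the monic polynomial over the subalgebra `ℚ[T̄]` to `ℚ[T]`
  set R₁ : Subalgebra ℚ F₀ := Algebra.adjoin ℚ (Set.range T) with hR₁
  obtain ⟨p, hpm, hp⟩ := hξ j
  let ρ : MvPolynomial (Fin r) ℚ →+* R₁ :=
    ((aeval T : MvPolynomial (Fin r) ℚ →ₐ[ℚ] F₀).codRestrict R₁ fun q => by
      rw [hR₁, ← MvPolynomial.aeval_range]; exact ⟨q, rfl⟩).toRingHom
  have hρsurj : Function.Surjective ρ := by
    rintro ⟨z, hz⟩
    rw [hR₁, ← MvPolynomial.aeval_range] at hz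
    obtain ⟨q, rfl⟩ := hz
    exact ⟨q, rfl⟩
  have hlift : p ∈ Polynomial.lifts ρ := by
    rw [Polynomial.lifts_iff_coeff_lifts]
    intro k; exact hρsurj _
  obtain ⟨q, hqp, -, hqm⟩ := Polynomial.lifts_and_natDegree_eq_and_monic hlift hpm
  refine ⟨q, hqm, ?_⟩
  have hcomp : (aeval T : MvPolynomial (Fin r) ℚ →ₐ[ℚ] F₀).toRingHom = (algebraMap R₁ F₀).comp ρ := by
    ext z <;> rfl
  rw [hcomp, ← Polynomial.map_map, hqp, Polynomial.eval_map]
  exact hp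

end Summit.ValiantsHypothesis.ValiantsHypothesis.Theorems.LangWeilTransfer
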